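import Mathlib.MeasureTheory.Function.L2Space
import Mathlib.MeasureTheory.Function.LpSeminorm.Indicator
import Mathlib.Analysis.InnerProductSpace.Orthogonal
import Mathlib.Analysis.InnerProductSpace.l2Space
import Mathlib.Dynamics.Ergodic.MeasurePreserving

/-!
# `L²` of a finite measurable partition is an orthogonal direct sum

Kernel witness (cell pub-hodge-repro2, seat p5, Tier 5) for the last sentence of
route/T5-N4-p5.md v12 (A3) STEP 1:

> «L^{K_f} = ⊕_{i=1}^{h} L²(Γ_i\G_∞) as unitary G_∞-modules»,

where the compact space `Y = G(F)\G(𝔸)/K_f` is the disjoint union of its finitely many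
open-and-closed `G_∞`-orbits `Y_1, …, Y_h` and `L^{K_f} = L²(Y)`.

What is kernel-checked here is the ABSTRACT measure-theoretic sentence only: for a measure
space `(X, μ)` and a measurable set `s`, the restriction `f ↦ 1_s·f` is a continuous linear
operator `restrictL hs` of norm `≤ 1` on `L^p(μ)`; it is idempotent, two such operators for
disjoint sets compose to `0`, the operators of a finite measurable partition sum to the
identity, and on `L²` they are self-adjoint.  Consequently the ranges `V hs` (the classes
vanishing a.e. off `s`) are closed subspaces, pairwise orthogonal for disjoint sets, with
`⨆ V (Y i) = ⊤` for a finite partition `(Y i)` — the internal orthogonal direct sum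
`L²(X) = ⊕_i L²(Y_i)` — and `‖restrictL hs f‖ = ‖f‖_{L²(μ|_s)}` identifies the `i`-th summand
with `L²(Y_i)`.  Finally, if a measure-preserving map `φ` satisfies `φ⁻¹(s) = s`, the unitary
composition operator `R(φ) = Lp.compMeasurePreserving φ` commutes with `restrictL hs` and
therefore preserves `V hs` — the «as unitary `G_∞`-modules» clause.

Nothing about groups, adèles, orbits, Haar measures or the representations of (A3) is
asserted: the identification of `Y` with the orbits, the invariance of the orbit measures and
the compactness of `[G]` stay prose ([C] + [P]) in (A3) STEP 1.  Mathlib only.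
-/

open MeasureTheory Set
open scoped ENNReal InnerProductSpace Function

namespace Summit.Ventures.HodgeRepro2.T5L2Partition

variable {X : Type*} [MeasurableSpace X] {μ : Measure X}
variable {𝕜 : Type*} [RCLike 𝕜] {E : Type*} [NormedAddCommGroup E] [InnerProductSpace 𝕜 E]
variable {p : ℝ≥0∞} [Fact (1 ≤ p)] {s t : Set X}

/-! ### The restriction operator `f ↦ 1_s · f` on `L^p` -/

/-- The restriction of an `L^p` class `f` to a measurable set `s`: the class of `s.indicator f`. -/
noncomputable def restrictLp (hs : MeasurableSet s) (f : Lp E p μ) : Lp E p μ :=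
  ((Lp.memLp f).indicator hs).toLp (s.indicator f)

omit [Fact (1 ≤ p)] in
/-- `restrictLp hs f` is represented by the pointwise indicator `s.indicator f`. -/
theorem coeFn_restrictLp (hs : MeasurableSet s) (f : Lp E p μ) :
    ⇑(restrictLp hs f) =ᵐ[μ] s.indicator f :=
  MemLp.coeFn_toLp _

omit [Fact (1 ≤ p)] in
/-- The restriction is additive. -/
theorem restrictLp_add (hs : MeasurableSet s) (f g : Lp E p μ) :
    restrictLp hs (f + g) = restrictLp hs f + restrictLp hs g := by
  apply Lp.ext
  filter_upwards [coeFn_restrictLp hs (f + g), coeFn_restrictLp hs f, coeFn_restrictLp hs g,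
    Lp.coeFn_add (restrictLp hs f) (restrictLp hs g), Lp.coeFn_add f g] with x h1 h2 h3 h4 h5
  rw [h4, Pi.add_apply, h2, h3, h1]
  by_cases hx : x ∈ s
  · simp only [Set.indicator_of_mem hx, h5, Pi.add_apply]
  · simp only [Set.indicator_of_notMem hx, add_zero]

omit [Fact (1 ≤ p)] in
/-- The restriction is homogeneous. -/
theorem restrictLp_smul (hs : MeasurableSet s) (c : 𝕜) (f : Lp E p μ) :
    restrictLp hs (c • f) = c • restrictLp hs f := by
  apply Lp.ext
  filter_upwards [coeFn_restrictLp hs (c • f), coeFn_restrictLp hs f,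
    Lp.coeFn_smul c (restrictLp hs f), Lp.coeFn_smul c f] with x h1 h2 h3 h4
  rw [h3, Pi.smul_apply, h2, h1]
  by_cases hx : x ∈ s
  · simp only [Set.indicator_of_mem hx, h4, Pi.smul_apply]
  · simp only [Set.indicator_of_notMem hx, smul_zero]

omit [Fact (1 ≤ p)] in
/-- The restriction does not increase the `L^p` norm. -/
theorem norm_restrictLp_le (hs : MeasurableSet s) (f : Lp E p μ) :
    ‖restrictLp hs f‖ ≤ ‖f‖ := by
  rw [restrictLp, Lp.norm_toLp, Lp.norm_def]
  exact ENNReal.toReal_mono (Lp.eLpNorm_ne_top f) (eLpNorm_indicator_le _)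

/-- The restriction to `s` as a continuous `𝕜`-linear operator on `L^p(μ)`. -/
noncomputable def restrictL (hs : MeasurableSet s) : Lp E p μ →L[𝕜] Lp E p μ :=
  LinearMap.mkContinuous
    { toFun := restrictLp hs
      map_add' := restrictLp_add hs
      map_smul' := restrictLp_smul hs } 1
    (fun f => by
      show ‖restrictLp hs f‖ ≤ 1 * ‖f‖
      rw [one_mul]
      exact norm_restrictLp_le hs f)

/-- `restrictL hs` acts as `restrictLp hs`. -/
@[simp]
theorem restrictL_apply (hs : MeasurableSet s) (f : Lp E p μ) :
    restrictL (𝕜 := 𝕜) hs f = restrictLp hs f := rfl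

/-- `restrictL hs f` is represented by the pointwise indicator `s.indicator f`. -/
theorem coeFn_restrictL (hs : MeasurableSet s) (f : Lp E p μ) :
    ⇑(restrictL (𝕜 := 𝕜) hs f) =ᵐ[μ] s.indicator f :=
  coeFn_restrictLp hs f

/-- The operator norm of the restriction is at most `1`. -/
theorem norm_restrictL_le (hs : MeasurableSet s) :
    ‖restrictL (𝕜 := 𝕜) (E := E) (μ := μ) (p := p) hs‖ ≤ 1 :=
  LinearMap.mkContinuous_norm_le _ zero_le_one _

/-- Two restrictions compose to the restriction to the intersection. -/
theorem restrictL_restrictL (hs : MeasurableSet s) (ht : MeasurableSet t) (f : Lp E p μ) :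
    restrictL (𝕜 := 𝕜) hs (restrictL (𝕜 := 𝕜) ht f) = restrictL (𝕜 := 𝕜) (hs.inter ht) f := by
  apply Lp.ext
  filter_upwards [coeFn_restrictL (𝕜 := 𝕜) hs (restrictL (𝕜 := 𝕜) ht f),
    (coeFn_restrictL (𝕜 := 𝕜) ht f).indicator (s := s),
    coeFn_restrictL (𝕜 := 𝕜) (hs.inter ht) f] with x h1 h2 h3
  rw [h1, h2, h3, Set.indicator_indicator]

/-- The restriction is idempotent. -/
theorem restrictL_restrictL_self (hs : MeasurableSet s) (f : Lp E p μ) :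
    restrictL (𝕜 := 𝕜) hs (restrictL (𝕜 := 𝕜) hs f) = restrictL (𝕜 := 𝕜) hs f := by
  rw [restrictL_restrictL]
  apply Lp.ext
  filter_upwards [coeFn_restrictL (𝕜 := 𝕜) (hs.inter hs) f, coeFn_restrictL (𝕜 := 𝕜) hs f]
    with x h1 h2
  rw [h1, h2, Set.inter_self]

/-- Restrictions to disjoint sets compose to zero. -/
theorem restrictL_restrictL_of_disjoint (hs : MeasurableSet s) (ht : MeasurableSet t)
    (hst : Disjoint s t) (f : Lp E p μ) :
    restrictL (𝕜 := 𝕜) hs (restrictL (𝕜 := 𝕜) ht f) = 0 := by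
  rw [restrictL_restrictL]
  apply Lp.ext
  filter_upwards [coeFn_restrictL (𝕜 := 𝕜) (hs.inter ht) f, Lp.coeFn_zero (E := E) (p := p) (μ := μ)]
    with x h1 h2
  rw [h1, h2, Set.disjoint_iff_inter_eq_empty.mp hst, Set.indicator_empty, Pi.zero_apply]

/-- The restrictions to the members of a finite measurable partition of `X` sum to the
identity. -/
theorem sum_restrictL {ι : Type*} [Fintype ι] {Y : ι → Set X} (hY : ∀ i, MeasurableSet (Y i))
    (hdisj : Pairwise (Disjoint on Y)) (hcov : ⋃ i, Y i = Set.univ) (f : Lp E p μ) :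
    ∑ i, restrictL (𝕜 := 𝕜) (hY i) f = f := by
  apply Lp.ext
  have hsum : ∀ᵐ x ∂μ, ∀ i, restrictL (𝕜 := 𝕜) (hY i) f x = (Y i).indicator f x :=
    ae_all_iff.mpr fun i => coeFn_restrictL (𝕜 := 𝕜) (hY i) f
  filter_upwards [Lp.coeFn_finsetSum (Finset.univ : Finset ι)
    (fun i => restrictL (𝕜 := 𝕜) (hY i) f), hsum] with x h1 h2
  rw [h1, Finset.sum_apply]
  simp only [h2]
  have hpd : ((Finset.univ : Finset ι) : Set ι).PairwiseDisjoint Y := fun i _ j _ hij => hdisj hij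
  rw [← Finset.indicator_biUnion_apply (Finset.univ : Finset ι) Y hpd x]
  have hU : ⋃ i ∈ (Finset.univ : Finset ι), Y i = Set.univ := by
    simpa only [Finset.mem_univ, Set.iUnion_true] using hcov
  rw [hU, Set.indicator_univ]

/-- The `L^p` norm of the restriction is the `L^p` norm of `f` for the restricted measure
`μ|_s` — the identification of the summand `V hs` with `L^p(s, μ|_s)`. -/
theorem norm_restrictL (hs : MeasurableSet s) (f : Lp E p μ) :
    ‖restrictL (𝕜 := 𝕜) hs f‖ = (eLpNorm f p (μ.restrict s)).toReal := by
  rw [restrictL_apply, restrictLp, Lp.norm_toLp, eLpNorm_indicator_eq_eLpNorm_restrict hs]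

/-! ### `L²`: self-adjointness, the subspaces `V hs`, orthogonality, the direct sum -/

/-- On `L²`, the restriction is self-adjoint: `⟪1_s f, g⟫ = ⟪f, 1_s g⟫`. -/
theorem inner_restrictL_left (hs : MeasurableSet s) (f g : Lp E 2 μ) :
    ⟪restrictL (𝕜 := 𝕜) hs f, g⟫_𝕜 = ⟪f, restrictL (𝕜 := 𝕜) hs g⟫_𝕜 := by
  rw [L2.inner_def, L2.inner_def]
  refine integral_congr_ae ?_
  filter_upwards [coeFn_restrictL (𝕜 := 𝕜) hs f, coeFn_restrictL (𝕜 := 𝕜) hs g] with x h1 h2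
  rw [h1, h2]
  by_cases hx : x ∈ s
  · simp only [Set.indicator_of_mem hx]
  · simp only [Set.indicator_of_notMem hx, inner_zero_left, inner_zero_right]

/-- The closed subspace of `L²(μ)` of the classes vanishing a.e. outside `s`
(the range of the restriction operator). -/
noncomputable def V (hs : MeasurableSet s) : Submodule 𝕜 (Lp E 2 μ) :=
  LinearMap.range (restrictL (𝕜 := 𝕜) (E := E) (μ := μ) (p := 2) hs : Lp E 2 μ →ₗ[𝕜] Lp E 2 μ)

/-- `f ∈ V hs` iff `f` is fixed by the restriction to `s`. -/
theorem mem_V_iff (hs : MeasurableSet s) (f : Lp E 2 μ) :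
    f ∈ V (𝕜 := 𝕜) hs ↔ restrictL (𝕜 := 𝕜) hs f = f := by
  simp only [V, LinearMap.mem_range, ContinuousLinearMap.coe_coe]
  constructor
  · rintro ⟨g, rfl⟩
    exact restrictL_restrictL_self hs g
  · intro h
    exact ⟨f, h⟩

/-- `f ∈ V hs` iff `f` vanishes a.e. outside `s`. -/
theorem mem_V_iff_ae (hs : MeasurableSet s) (f : Lp E 2 μ) :
    f ∈ V (𝕜 := 𝕜) hs ↔ ∀ᵐ x ∂μ, x ∉ s → f x = 0 := by
  rw [mem_V_iff]
  constructor
  · intro h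
    filter_upwards [coeFn_restrictL (𝕜 := 𝕜) hs f] with x hx hxs
    rw [h] at hx
    rw [hx, Set.indicator_of_notMem hxs]
  · intro h
    apply Lp.ext
    filter_upwards [coeFn_restrictL (𝕜 := 𝕜) hs f, h] with x h1 h2
    rw [h1]
    by_cases hx : x ∈ s
    · rw [Set.indicator_of_mem hx]
    · rw [Set.indicator_of_notMem hx, h2 hx]

/-- `restrictL hs f ∈ V hs`. -/
theorem restrictL_mem_V (hs : MeasurableSet s) (f : Lp E 2 μ) :
    restrictL (𝕜 := 𝕜) hs f ∈ V (𝕜 := 𝕜) hs :=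
  (mem_V_iff hs _).mpr (restrictL_restrictL_self hs f)

/-- `V hs` is closed: it is the kernel of the continuous operator `restrictL hs - 1`. -/
theorem isClosed_V (hs : MeasurableSet s) :
    IsClosed (V (𝕜 := 𝕜) (E := E) (μ := μ) hs : Set (Lp E 2 μ)) := by
  have h : (V (𝕜 := 𝕜) (E := E) (μ := μ) hs : Set (Lp E 2 μ)) =
      (LinearMap.ker ((restrictL (𝕜 := 𝕜) (E := E) (μ := μ) (p := 2) hs -
        ContinuousLinearMap.id 𝕜 (Lp E 2 μ) : Lp E 2 μ →L[𝕜] Lp E 2 μ) :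
          Lp E 2 μ →ₗ[𝕜] Lp E 2 μ) : Set (Lp E 2 μ)) := by
    ext f
    simp only [SetLike.mem_coe, mem_V_iff, LinearMap.mem_ker, ContinuousLinearMap.coe_coe,
      sub_apply, ContinuousLinearMap.id_apply, sub_eq_zero]
  rw [h]
  exact ContinuousLinearMap.isClosed_ker _

/-- The subspaces attached to disjoint sets are orthogonal. -/
theorem V_isOrtho (hs : MeasurableSet s) (ht : MeasurableSet t) (hst : Disjoint s t) :
    V (𝕜 := 𝕜) (E := E) (μ := μ) hs ⟂ V (𝕜 := 𝕜) ht := by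
  rw [Submodule.isOrtho_iff_inner_eq]
  intro u hu v hv
  have hu' := (mem_V_iff hs u).mp hu
  have hv' := (mem_V_iff ht v).mp hv
  rw [← hu', ← hv', inner_restrictL_left, restrictL_restrictL_of_disjoint hs ht hst,
    inner_zero_right]

/-- For a finite measurable partition `(Y i)` of `X`, the subspaces `V (Y i)` span `L²(μ)`:
every `f` is the finite sum of its restrictions. -/
theorem iSup_V_eq_top {ι : Type*} [Fintype ι] {Y : ι → Set X} (hY : ∀ i, MeasurableSet (Y i))
    (hdisj : Pairwise (Disjoint on Y)) (hcov : ⋃ i, Y i = Set.univ) :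
    ⨆ i, V (𝕜 := 𝕜) (E := E) (μ := μ) (hY i) = ⊤ := by
  rw [eq_top_iff]
  intro f _
  rw [← sum_restrictL (𝕜 := 𝕜) hY hdisj hcov f]
  exact Submodule.sum_mem_iSup fun i => restrictL_mem_V (hY i) f

/-- The subspaces of a finite measurable partition form an orthogonal family (Mathlib's
`OrthogonalFamily`, with the inclusions `subtypeₗᵢ`). -/
theorem orthogonalFamily_V {ι : Type*} {Y : ι → Set X} (hY : ∀ i, MeasurableSet (Y i))
    (hdisj : Pairwise (Disjoint on Y)) :
    OrthogonalFamily 𝕜 (fun i => V (𝕜 := 𝕜) (E := E) (μ := μ) (hY i))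
      fun i => (V (𝕜 := 𝕜) (E := E) (μ := μ) (hY i)).subtypeₗᵢ :=
  OrthogonalFamily.of_pairwise fun i j hij => V_isOrtho (hY i) (hY j) (hdisj hij)

/-- `L²(μ) = ⊕_i L²(Y_i)` as a Hilbert sum (Mathlib's `IsHilbertSum`) for a finite measurable
partition `(Y i)` of `X` and complete `E`. -/
theorem isHilbertSum_V [CompleteSpace E] {ι : Type*} [Fintype ι] {Y : ι → Set X}
    (hY : ∀ i, MeasurableSet (Y i)) (hdisj : Pairwise (Disjoint on Y))
    (hcov : ⋃ i, Y i = Set.univ) :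
    IsHilbertSum 𝕜 (fun i => V (𝕜 := 𝕜) (E := E) (μ := μ) (hY i))
      fun i => (V (𝕜 := 𝕜) (E := E) (μ := μ) (hY i)).subtypeₗᵢ := by
  haveI : ∀ i, CompleteSpace (V (𝕜 := 𝕜) (E := E) (μ := μ) (hY i)) :=
    fun i => (isClosed_V (hY i)).isComplete.completeSpace_coe
  refine IsHilbertSum.mkInternal _ (orthogonalFamily_V hY hdisj) ?_
  exact (iSup_V_eq_top (𝕜 := 𝕜) hY hdisj hcov).symm.le.trans (Submodule.le_topologicalClosure _)

/-- Pythagoras for the partition: `‖f‖² = Σ_i ‖1_{Y_i} f‖²`. -/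
theorem sum_norm_sq_restrictL {ι : Type*} [Fintype ι] {Y : ι → Set X}
    (hY : ∀ i, MeasurableSet (Y i)) (hdisj : Pairwise (Disjoint on Y))
    (hcov : ⋃ i, Y i = Set.univ) (f : Lp E 2 μ) :
    ∑ i, ‖restrictL (𝕜 := 𝕜) (hY i) f‖ ^ 2 = ‖f‖ ^ 2 := by
  have h := (orthogonalFamily_V (𝕜 := 𝕜) hY hdisj).norm_sum
    (fun i => (⟨restrictL (𝕜 := 𝕜) (hY i) f, restrictL_mem_V (hY i) f⟩ :
      V (𝕜 := 𝕜) (E := E) (μ := μ) (hY i))) Finset.univ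
  simp only [Submodule.coe_subtypeₗᵢ, Submodule.coe_subtype, Submodule.coe_norm] at h
  rw [sum_restrictL (𝕜 := 𝕜) hY hdisj hcov f] at h
  exact h.symm

/-! ### Equivariance under a measure-preserving map fixing `s` -/

section Equivariance

variable {φ : X → X}

/-- If `φ` is measure-preserving and `φ⁻¹(s) = s`, the composition operator `f ↦ f ∘ φ` on `L^p`
commutes with the restriction to `s`. -/
theorem compMeasurePreserving_restrictL (hφ : MeasurePreserving φ μ μ) (hs : MeasurableSet s)
    (hφs : φ ⁻¹' s = s) (f : Lp E p μ) :
    Lp.compMeasurePreserving φ hφ (restrictL (𝕜 := 𝕜) hs f) =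
      restrictL (𝕜 := 𝕜) hs (Lp.compMeasurePreserving φ hφ f) := by
  apply Lp.ext
  have h1 : ⇑(restrictL (𝕜 := 𝕜) hs f) ∘ φ =ᵐ[μ] s.indicator f ∘ φ :=
    hφ.quasiMeasurePreserving.ae_eq_comp (coeFn_restrictL (𝕜 := 𝕜) hs f)
  filter_upwards [Lp.coeFn_compMeasurePreserving (restrictL (𝕜 := 𝕜) hs f) hφ, h1,
    coeFn_restrictL (𝕜 := 𝕜) hs (Lp.compMeasurePreserving φ hφ f),
    (Lp.coeFn_compMeasurePreserving f hφ).indicator (s := s)] with x h2 h3 h4 h5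
  rw [h2, h3, h4, h5, Function.comp_apply, ← Set.indicator_comp_right φ, hφs]

/-- The composition operator of a measure-preserving `φ` with `φ⁻¹(s) = s` preserves `V hs`. -/
theorem compMeasurePreserving_mem_V (hφ : MeasurePreserving φ μ μ) (hs : MeasurableSet s)
    (hφs : φ ⁻¹' s = s) {f : Lp E 2 μ} (hf : f ∈ V (𝕜 := 𝕜) hs) :
    Lp.compMeasurePreserving φ hφ f ∈ V (𝕜 := 𝕜) hs := by
  rw [mem_V_iff] at hf ⊢
  rw [← compMeasurePreserving_restrictL hφ hs hφs, hf]

/-- The same, for the linear-isometry form of the composition operator. -/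
theorem map_V_le (hφ : MeasurePreserving φ μ μ) (hs : MeasurableSet s) (hφs : φ ⁻¹' s = s) :
    (V (𝕜 := 𝕜) (E := E) (μ := μ) hs).map
        (Lp.compMeasurePreservingₗᵢ (E := E) (p := 2) 𝕜 φ hφ).toLinearMap ≤ V (𝕜 := 𝕜) hs := by
  rintro _ ⟨f, hf, rfl⟩
  exact compMeasurePreserving_mem_V hφ hs hφs hf

end Equivariance

end Summit.Ventures.HodgeRepro2.T5L2Partition
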